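import Summits.CriticalPhenomena.PercolationContinuityZ3.Theorems.PercNearOneGluingNoHeavyLowerTailSunflowerLawJoin
import HarnessLib

/-!
# `NoHeavyLowerTail` (crux stmt-CriticalPhenomena-4575), abstract sunflower cubic at LAW level: FOUR-POINT NORMAL FORMS — every point of the
# law region `W ∩ {ab > 0}` is the law of an explicit sunflower on four coordinates, so (C1-law) ⟺ "the realizable law region is `W`"

Support file (seat `prim-ineq-gen-2` gen 30; `--supports stmt-CriticalPhenomena-4575`).  Nothing is asserted about the crux; no `sorry`, no named
facts, standard axioms.  Memo: run/shared/lean/prim/prim-ineq-gen-2/LAW-REGION-GEN30.md §1.  After `…SunflowerLawJoin` (`massVec`, `massVec_join`)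
and `…SunflowerLawRegion` (`normalForm`, `exists_normalForm_of_LBform_nonneg`, `dualLaw`).

RESULTS [this work]:
* one-point sunflowers `petalLit i`, `coreLit` and their laws (`massVec_petalLit = litLaw`, `massVec_coreLit = topLaw`);
* the DUAL sunflower `F.dual` (`S ↦` bottom/top-swapped label of `Sᶜ`) with `massVec_dual : F.dual.massVec p = dualLaw (F.massVec (1 − p))`;
* the four-point structure `nf4 = petalLit 0 ∨ petalLit 1 ∨ petalLit 2 ∨ coreLit` (θ-joins) with `massVec_nf4 = normalForm w₁ w₂ w₃ z`;
* **`exists_realization_of_mem_regionW`**: every `m ≥ 0` with `Σ m = 1`, `m₀ > 0`, `m₄ > 0` and `m ∈ W` (i.e. `LA(m) ≥ 0 ∨ LB(m) ≥ 0`) is the cell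
  vector of `nf4` or of `nf4.dual` under an explicit product measure with parameters in `[0,1]`.  Since gen 29 / prove-1's (C1-law) asserts the
  converse inclusion (every sunflower law lies in `W`), (C1-law) is EQUIVALENT to the statement that the closed law region of three-petal
  sunflowers is exactly `{(b,c,a) : e₃(c) ≤ max(a,b)·(ab − e₂(c))}` (up to the faces `ab = 0`), and it implies that every sunflower law is already a
  four-point law.
-/

noncomputable section

namespace Summit.CriticalPhenomena.PercolationContinuityZ3.Theorems.SunflowerPartition

open Finset LawPencil LawRegion

/-! ## One-point sunflowers -/

/-- The PETAL LITERAL on one point: the point, when present, carries colour `i`. [this work] -/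
def petalLit (i : Fin 3) : Sunflower Unit where
  V j := if j = i then {univ} else ∅
  upper j := by
    intro S T hST hS
    by_cases h : j = i
    · simp only [h, if_true, coe_singleton, Set.mem_singleton_iff] at hS ⊢
      subst hS
      exact subset_antisymm (subset_univ T) hST
    · simp [h] at hS
  inter_eq j k hjk := by
    fin_cases i <;> fin_cases j <;> fin_cases k <;> simp_all

/-- The CORE LITERAL on one point: the point, when present, carries the kernel label. [this work] -/
def coreLit : Sunflower Unit where
  V _ := {univ}
  upper j := by
    intro S T hST hS
    simp only [coe_singleton, Set.mem_singleton_iff] at hS ⊢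
    subst hS
    exact subset_antisymm (subset_univ T) hST
  inter_eq _ _ _ := rfl

/-- The two subsets of the one-point cube. [folklore] -/
theorem univ_finset_unit : (univ : Finset (Finset Unit)) = {∅, univ} := by decide

/-- Product weight of the empty configuration on one point. [this work] -/
theorem wP_unit_empty (w : ℝ) : wP (fun _ : Unit => w) ∅ = 1 - w := by
  unfold wP; simp

/-- Product weight of the full configuration on one point. [this work] -/
theorem wP_unit_univ (w : ℝ) : wP (fun _ : Unit => w) univ = w := by
  unfold wP; simp

/-- A cell mass on the one-point cube. [this work] -/
theorem mass_unit (lab : Finset Unit → Fin 5) (w : ℝ) (v : Fin 5) :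
    mass lab (fun _ => w) v = (if lab ∅ = v then 1 - w else 0) + (if lab univ = v then w else 0) := by
  unfold mass
  rw [univ_finset_unit, sum_pair (by decide), wP_unit_empty, wP_unit_univ]

/-- Labels of the petal literal. [this work] -/
theorem lab_petalLit (i : Fin 3) : (petalLit i).lab ∅ = 0 ∧ (petalLit i).lab univ = ⟨i.val + 1, by omega⟩ := by
  fin_cases i <;> decide

/-- Labels of the core literal. [this work] -/
theorem lab_coreLit : coreLit.lab ∅ = 0 ∧ coreLit.lab univ = 4 := by decide

/-- **Law of a petal literal**: `(1 − w)` on the bottom, `w` on petal `i`. [this work] -/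
theorem massVec_petalLit (i : Fin 3) (w : ℝ) : (petalLit i).massVec (fun _ => w) = litLaw ⟨i.val + 1, by omega⟩ w := by
  ext v
  rw [Sunflower.massVec_apply, mass_unit, (lab_petalLit i).1, (lab_petalLit i).2]
  unfold litLaw
  fin_cases i <;> fin_cases v <;> simp

/-- **Law of the core literal**: `(1 − z)` on the bottom, `z` on the kernel. [this work] -/
theorem massVec_coreLit (z : ℝ) : coreLit.massVec (fun _ => z) = topLaw z := by
  ext v
  rw [Sunflower.massVec_apply, mass_unit, lab_coreLit.1, lab_coreLit.2]
  unfold topLaw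
  fin_cases v <;> simp

/-! ## The dual sunflower -/

section Dual

variable {α : Type*} [Fintype α] [DecidableEq α]

/-- Swap of bottom and top in `M₃` (petals fixed). [folklore] -/
def swapBT (v : Fin 5) : Fin 5 := if v = 0 then 4 else if v = 4 then 0 else v

/-- `swapBT` is an involution. [folklore] -/
theorem swapBT_swapBT : ∀ v : Fin 5, swapBT (swapBT v) = v := by decide

/-- `dualLaw` reads the swapped cell. [this work] -/
theorem dualLaw_apply (m : Fin 5 → ℝ) (v : Fin 5) : dualLaw m v = m (swapBT v) := by
  fin_cases v <;> rfl

/-- **The dual sunflower**: `S` gets the bottom/top-swapped label of `Sᶜ`; its up-set `i` is `{S : Sᶜ ∉ V j, Sᶜ ∉ V k}` (`{j,k} = {i}ᶜ`).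
[folklore (order duality); this encoding this work] -/
def Sunflower.dual (F : Sunflower α) : Sunflower α where
  V i := univ.filter fun S => ∀ j, j ≠ i → Sᶜ ∉ F.V j
  upper i := by
    intro S T hST hS
    rw [Finset.mem_coe, mem_filter] at hS ⊢
    refine ⟨mem_univ _, fun j hj hT => hS.2 j hj ?_⟩
    exact F.mem_V_of_subset (compl_subset_compl.2 hST) hT
  inter_eq i j hij := by
    ext S
    simp only [mem_inter, mem_filter, mem_univ, true_and]
    constructor
    · rintro ⟨hi, hj⟩
      have hall : ∀ k, Sᶜ ∉ F.V k := fun k => by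
        by_cases hk : k = i
        · rw [hk]; exact hj i hij
        · exact hi k hk
      exact ⟨fun k _ => hall k, fun k _ => hall k⟩
    · rintro ⟨h0, h1⟩
      have hall : ∀ k, Sᶜ ∉ F.V k := fun k => by
        by_cases hk : k = 0
        · rw [hk]; exact h1 0 (by decide)
        · exact h0 k hk
      exact ⟨fun k _ => hall k, fun k _ => hall k⟩

/-- **Labels of the dual**: `F.dual.lab S = swapBT (F.lab Sᶜ)`. [this work] -/
theorem Sunflower.lab_dual (F : Sunflower α) (S : Finset α) : F.dual.lab S = swapBT (F.lab Sᶜ) := by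
  have hV : ∀ i, S ∈ F.dual.V i ↔ ∀ j, j ≠ i → Sᶜ ∉ F.V j := fun i => by simp [Sunflower.dual]
  have hA : S ∈ F.dual.A ↔ ∀ j, Sᶜ ∉ F.V j := by
    unfold Sunflower.A
    rw [mem_inter, hV, hV]
    constructor
    · rintro ⟨h0, h1⟩ k
      by_cases hk : k = 0
      · subst hk; exact h1 0 (by decide)
      · exact h0 k hk
    · intro h; exact ⟨fun k _ => h k, fun k _ => h k⟩
  by_cases hSA : Sᶜ ∈ F.A
  · -- label of `Sᶜ` is top: dual label bottom
    have h4 : F.lab Sᶜ = 4 := by unfold Sunflower.lab; rw [if_pos hSA]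
    have hm : ∀ i, Sᶜ ∈ F.V i := fun i => by
      have h := hSA
      unfold Sunflower.A at h
      fin_cases i
      · exact (mem_inter.1 h).1
      · exact (mem_inter.1 h).2
      · rw [← F.inter_eq 0 2 (by decide)] at h
        exact (mem_inter.1 h).2
    rw [h4]
    unfold Sunflower.lab
    rw [if_neg (fun h => (hA.1 h) 0 (hm 0)), if_neg (fun h => ((hV 0).1 h) 1 (by decide) (hm 1)),
      if_neg (fun h => ((hV 1).1 h) 0 (by decide) (hm 0)), if_neg (fun h => ((hV 2).1 h) 0 (by decide) (hm 0))]
    decide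
  · by_cases h0 : Sᶜ ∈ F.V 0
    · have h1 : Sᶜ ∉ F.V 1 := fun h => hSA (F.mem_A_of_mem_mem (by decide) h0 h)
      have h2 : Sᶜ ∉ F.V 2 := fun h => hSA (F.mem_A_of_mem_mem (by decide) h0 h)
      have hl : F.lab Sᶜ = 1 := by unfold Sunflower.lab; rw [if_neg hSA, if_pos h0]
      rw [hl]
      have hd0 : S ∈ F.dual.V 0 := (hV 0).2 fun j hj => by
        fin_cases j
        · exact absurd rfl hj
        · exact h1
        · exact h2
      have hdA : S ∉ F.dual.A := fun h => (hA.1 h) 0 h0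
      unfold Sunflower.lab; rw [if_neg hdA, if_pos hd0]; decide
    · by_cases h1 : Sᶜ ∈ F.V 1
      · have h2 : Sᶜ ∉ F.V 2 := fun h => hSA (by
          have := F.mem_A_of_mem_mem (i := 1) (j := 2) (by decide) h1 h; exact this)
        have hl : F.lab Sᶜ = 2 := by unfold Sunflower.lab; rw [if_neg hSA, if_neg h0, if_pos h1]
        rw [hl]
        have hd1 : S ∈ F.dual.V 1 := (hV 1).2 fun j hj => by
          fin_cases j
          · exact h0
          · exact absurd rfl hj
          · exact h2
        have hd0 : S ∉ F.dual.V 0 := fun h => ((hV 0).1 h) 1 (by decide) h1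
        have hdA : S ∉ F.dual.A := fun h => (hA.1 h) 1 h1
        unfold Sunflower.lab; rw [if_neg hdA, if_neg hd0, if_pos hd1]; decide
      · by_cases h2 : Sᶜ ∈ F.V 2
        · have hl : F.lab Sᶜ = 3 := by unfold Sunflower.lab; rw [if_neg hSA, if_neg h0, if_neg h1, if_pos h2]
          rw [hl]
          have hd2 : S ∈ F.dual.V 2 := (hV 2).2 fun j hj => by
            fin_cases j
            · exact h0
            · exact h1
            · exact absurd rfl hj
          have hd0 : S ∉ F.dual.V 0 := fun h => ((hV 0).1 h) 2 (by decide) h2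
          have hd1 : S ∉ F.dual.V 1 := fun h => ((hV 1).1 h) 2 (by decide) h2
          have hdA : S ∉ F.dual.A := fun h => (hA.1 h) 2 h2
          unfold Sunflower.lab; rw [if_neg hdA, if_neg hd0, if_neg hd1, if_pos hd2]; decide
        · have hl : F.lab Sᶜ = 0 := by unfold Sunflower.lab; rw [if_neg hSA, if_neg h0, if_neg h1, if_neg h2]
          rw [hl]
          have hdA : S ∈ F.dual.A := hA.2 fun j => by
            fin_cases j
            · exact h0
            · exact h1
            · exact h2
          unfold Sunflower.lab; rw [if_pos hdA]; decide

/-- Product weights of a complement are the weights of the complementary parameters. [folklore] -/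
theorem wP_compl (p : α → ℝ) (S : Finset α) : wP p Sᶜ = wP (fun x => 1 - p x) S := by
  unfold wP
  refine prod_congr rfl fun x _ => ?_
  by_cases hx : x ∈ S
  · rw [if_neg (fun h => (mem_compl.1 h) hx), if_pos hx]
  · rw [if_pos (mem_compl.2 hx), if_neg hx, sub_sub_cancel]

/-- **Law of the dual**: `F.dual.massVec p = dualLaw (F.massVec (1 − p))`. [this work] -/
theorem Sunflower.massVec_dual (F : Sunflower α) (p : α → ℝ) :
    F.dual.massVec p = dualLaw (F.massVec fun x => 1 - p x) := by
  ext v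
  rw [dualLaw_apply, Sunflower.massVec_apply, Sunflower.massVec_apply]
  unfold mass
  refine Fintype.sum_equiv ⟨compl, compl, compl_compl, compl_compl⟩ _ _ (fun S => ?_)
  show (if F.dual.lab S = v then wP p S else 0) = (if F.lab Sᶜ = swapBT v then wP (fun x => 1 - p x) Sᶜ else 0)
  rw [F.lab_dual, ← wP_compl p Sᶜ, compl_compl]
  by_cases h : F.lab Sᶜ = swapBT v
  · rw [if_pos h, if_pos (by rw [h, swapBT_swapBT])]
  · rw [if_neg h, if_neg (fun h' => h (by rw [← h', swapBT_swapBT]))]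

omit [Fintype α] [DecidableEq α] in
/-- The dual of `p ∈ [0,1]^α` is in `[0,1]^α`. [folklore] -/
theorem unitParam_compl {p : α → ℝ} (hp : ∀ x, 0 ≤ p x ∧ p x ≤ 1) : ∀ x, 0 ≤ 1 - p x ∧ 1 - p x ≤ 1 :=
  fun x => ⟨by linarith [(hp x).2], by linarith [(hp x).1]⟩


/-- **`W` is inherited by duals** (hence by θ-MEETS, the duals of joins of duals): if the law of `F` under `1 − p` lies in `W`, so does the law
of `F.dual` under `p`. [this work] -/
theorem Sunflower.massVec_dual_mem_regionW (F : Sunflower α) {p : α → ℝ} (hF : F.massVec (fun x => 1 - p x) ∈ regionW) :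
    F.dual.massVec p ∈ regionW := by
  rw [F.massVec_dual]
  exact inW_dualLaw hF

end Dual

/-! ## The four-point normal form and the realizability theorem -/

/-- The ground type of the four-point normal form (four one-point blocks). [this work] -/
abbrev NF4 : Type := Unit ⊕ (Unit ⊕ (Unit ⊕ Unit))

/-- **The four-point normal form** `petalLit 0 ∨ petalLit 1 ∨ petalLit 2 ∨ coreLit` (θ-joins). [this work] -/
def nf4 : Sunflower NF4 := (petalLit 0).join ((petalLit 1).join ((petalLit 2).join coreLit))

/-- Its parameter vector. [this work] -/
def nf4Param (w₁ w₂ w₃ z : ℝ) : NF4 → ℝ := Sum.elim (fun _ => w₁) (Sum.elim (fun _ => w₂) (Sum.elim (fun _ => w₃) (fun _ => z)))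

/-- The parameters lie in `[0,1]` when the four numbers do. [this work] -/
theorem nf4Param_mem {w₁ w₂ w₃ z : ℝ} (h₁ : 0 ≤ w₁ ∧ w₁ ≤ 1) (h₂ : 0 ≤ w₂ ∧ w₂ ≤ 1) (h₃ : 0 ≤ w₃ ∧ w₃ ≤ 1) (hz : 0 ≤ z ∧ z ≤ 1) :
    ∀ x, 0 ≤ nf4Param w₁ w₂ w₃ z x ∧ nf4Param w₁ w₂ w₃ z x ≤ 1 := by
  rintro (_ | _ | _ | _) <;> simp [nf4Param] <;> tauto

/-- **The law of the four-point normal form is `normalForm`.** [this work] -/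
theorem massVec_nf4 (w₁ w₂ w₃ z : ℝ) : nf4.massVec (nf4Param w₁ w₂ w₃ z) = normalForm w₁ w₂ w₃ z := by
  unfold nf4 nf4Param normalForm
  rw [Sunflower.massVec_join, Sunflower.massVec_join, Sunflower.massVec_join, massVec_petalLit, massVec_petalLit, massVec_petalLit,
    massVec_coreLit]
  rfl

/-- **REALIZABILITY OF THE SHEET SIDE `LB ≥ 0`**: every nonnegative cell vector of mass one with positive bottom and `LB ≥ 0` is the law of
the four-point sunflower `nf4` under a product measure. [this work] -/
theorem exists_realization_of_LBform_nonneg {m : Fin 5 → ℝ} (hm : ∀ i, 0 ≤ m i) (htot : total m = 1) (hb : 0 < m 0)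
    (hLB : 0 ≤ LBform m) :
    ∃ p : NF4 → ℝ, (∀ x, 0 ≤ p x ∧ p x ≤ 1) ∧ nf4.massVec p = m := by
  obtain ⟨w₁, w₂, w₃, z, h₁, h₂, h₃, hz, e⟩ := exists_normalForm_of_LBform_nonneg hm htot hb hLB
  exact ⟨nf4Param w₁ w₂ w₃ z, nf4Param_mem h₁ h₂ h₃ hz, by rw [massVec_nf4, e]⟩

/-- **REALIZABILITY OF THE SHEET SIDE `LA ≥ 0`** by the dual structure. [this work] -/
theorem exists_realization_of_LAform_nonneg {m : Fin 5 → ℝ} (hm : ∀ i, 0 ≤ m i) (htot : total m = 1) (ha : 0 < m 4)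
    (hLA : 0 ≤ LAform m) :
    ∃ p : NF4 → ℝ, (∀ x, 0 ≤ p x ∧ p x ≤ 1) ∧ nf4.dual.massVec p = m := by
  obtain ⟨w₁, w₂, w₃, z, h₁, h₂, h₃, hz, e⟩ := exists_dual_normalForm_of_LAform_nonneg hm htot ha hLA
  refine ⟨fun x => 1 - nf4Param w₁ w₂ w₃ z x, unitParam_compl (nf4Param_mem h₁ h₂ h₃ hz), ?_⟩
  rw [Sunflower.massVec_dual]
  simp only [sub_sub_cancel]
  rw [massVec_nf4, e]

/-- **`W ∩ {ab > 0}` IS REALIZABLE ON FOUR POINTS**: every `m ≥ 0` of mass one with `m₀, m₄ > 0` and `LA(m) ≥ 0 ∨ LB(m) ≥ 0` is the cell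
vector of a sunflower on the four-point ground type `NF4` (the normal form or its dual) under a product measure with parameters in `[0,1]`.
Together with (C1-law) (prove-1; every sunflower law lies in `W`) this identifies the closed law region with `W`. [this work] -/
theorem exists_realization_of_mem_regionW {m : Fin 5 → ℝ} (hm : ∀ i, 0 ≤ m i) (htot : total m = 1) (hb : 0 < m 0) (ha : 0 < m 4)
    (hW : m ∈ regionW) :
    ∃ F : Sunflower NF4, ∃ p : NF4 → ℝ, (∀ x, 0 ≤ p x ∧ p x ≤ 1) ∧ F.massVec p = m := by
  rcases hW with h | h
  · obtain ⟨p, hp, e⟩ := exists_realization_of_LAform_nonneg hm htot ha h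
    exact ⟨nf4.dual, p, hp, e⟩
  · obtain ⟨p, hp, e⟩ := exists_realization_of_LBform_nonneg hm htot hb h
    exact ⟨nf4, p, hp, e⟩

end Summit.CriticalPhenomena.PercolationContinuityZ3.Theorems.SunflowerPartition
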